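import Mathlib
import HarnessLib
import Summits.NavierStokesRegularity.NavierStokesRegularity.Theorems.PoloidalWindowDoorLrcModEntireRidgeFrameOpen
import Summits.NavierStokesRegularity.NavierStokesRegularity.Theorems.PoloidalWindowDoorLrcModEntireRidgeArgmax
import Summits.NavierStokesRegularity.NavierStokesRegularity.Theorems.PoloidalWindowDoorLrcModEntireRidgeDanskin
import Summits.NavierStokesRegularity.NavierStokesRegularity.Theorems.PoloidalWindowDoorLrcModEntireRidgeWebEntrance

/-!
# Item `LrcModEntire` (stmt-NavierStokesRegularity-20428) — (Q4) entrance, ONE-SHOT WEB FERMAT: on a homogeneous ridge every cross-section carries a unique interior web point,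
# the homogeneous maximum `R(τ,z)` is differentiable, and `D(uncurry F) = D(uncurry R) ∘ ((τ,y) ↦ (τ,y₂))` at the web point — from ANALYTIC hypotheses only

ns-k2-port-2 g5 (helper prover under the LEAD of item 20428, ns-poloidal-K2-p3 g14; `--supports stmt-NavierStokesRegularity-20428 --as helper`).
Composition of the LEAD's `…RidgeWebEntrance.fderiv_uncurry_eq_of_ridgeWeb` with this seat's `…RidgeFrameOpen` (hΨ), `…RidgeArgmax` (unique maximiser), `…RidgeDanskin` (hR);
the `hle`/`heq` inputs are derived inline.  Hypotheses (class-free; `F τ = σU₂(−1+τ,·)` for the hull limit of `…RidgeHullValues`, `Ψ(s,n,z) = Γ s + nν_Γ s + z e₂`):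
`uncurry F` of class `C²` on `T × ℝ³` (`T ⊇ (−δ,δ)` open); a complete `C²` unit-speed frame `(Γ, ν_Γ)` in `P₀` with curvature `≤ B`, `r·B < 1`; HOMOGENEITY of the cross-section
maximum (`∀ s, sSup(cross-section s) = sSup(cross-section 0)` = the (Q3∞) output); STRICT COLD LATERAL values (`F τ (Ψ(s,±r,z)) < m τ z ≤ F τ (Ψ(s,0,z))`, (U-LL) for the limit);
STRICT CONCAVITY of every cross-section (`D²(F τ)(Ψ(s,n,z))(ν s, ν s) < 0` for `|n| < r` — transversal non-degeneracy on the thin tube).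

* `hasDerivAt_crossSection`, `strictConcaveOn_crossSection` — the cross-section `n ↦ F τ (Ψ(s,n,z))` has derivative `D(F τ)(ν s)` and is strictly concave on `[−r,r]`;
* `hasFDerivAt_crossSectionFamily` — Danskin's differentiability hypothesis for the family `(τ,z) ↦ F τ (Ψ(s,n,z))`;
* **`web_fermat`** — for every `|τ₀|,|z₀| < δ` and every `s₀`: ∃! interior web point `n₀ ∈ (−r,r)` of the `s₀`-cross-section (`F τ₀ (Ψ(s₀,n₀,z₀)) = R τ₀ z₀`, strict
  elsewhere), `uncurry R` is differentiable at `(τ₀,z₀)`, and `fderiv ℝ (uncurry F) (τ₀, Ψ(s₀,n₀,z₀)) = (fderiv ℝ (uncurry R) (τ₀,z₀)).comp ((τ,y) ↦ (τ,y₂))`.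

WHAT THIS IS NOT: not a claim about Navier–Stokes regularity — the first-order web law at the entrance of the research cell (Q4) «HOMOGENEOUS NULL RIDGE» on hypothetical profiles
(bears_on LADDER-NS N0, item 20428 / crux 19708; 20428/19708/27893 OPEN; (Q4) OPEN).  No summit statement is proved here.
-/

noncomputable section

-- the summit and its single sub-problem share the name (CONVENTIONS §1), as in every Theorems file
set_option linter.dupNamespace false

namespace Summit.NavierStokesRegularity.NavierStokesRegularity.Theorems.PoloidalWindowDoorLrcModEntireRidgeWebFermat

open Set Filter Topology Metric Function
open Summit.NavierStokesRegularity.NavierStokesRegularity.Theorems.PoloidalWindowDoorLrcModEntireRidgeFrameOpen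
open Summit.NavierStokesRegularity.NavierStokesRegularity.Theorems.PoloidalWindowDoorLrcModEntireRidgeArgmax
open Summit.NavierStokesRegularity.NavierStokesRegularity.Theorems.PoloidalWindowDoorLrcModEntireRidgeDanskin
open Summit.NavierStokesRegularity.NavierStokesRegularity.Theorems.PoloidalWindowDoorLrcModEntireRidgeWebEntrance

variable {F : ℝ → EuclideanSpace ℝ (Fin 3) → ℝ} {T : Set ℝ}

/-- A slice `F τ`, `τ ∈ T`, is `C²` when `uncurry F` is `C²` on `T × ℝ³`. -/
theorem contDiff_slice (hF : ContDiffOn ℝ 2 (uncurry F) (T ×ˢ (univ : Set (EuclideanSpace ℝ (Fin 3)))))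
    {τ : ℝ} (hτ : τ ∈ T) : ContDiff ℝ 2 (F τ) := by
  have h : ContDiffOn ℝ 2 (uncurry F ∘ fun y : EuclideanSpace ℝ (Fin 3) => (τ, y)) univ :=
    hF.comp (contDiff_const.prodMk contDiff_id).contDiffOn fun y _ => ⟨hτ, mem_univ _⟩
  rw [contDiffOn_univ] at h
  exact h

/-- **Derivative of a cross-section** `n ↦ F τ (c + n • w + d)`: `D(F τ)(c + n•w + d)(w)`. -/
theorem hasDerivAt_crossSection {τ : ℝ} (hFτ : ContDiff ℝ 2 (F τ)) (c w d : EuclideanSpace ℝ (Fin 3)) (n : ℝ) :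
    HasDerivAt (fun n : ℝ => F τ (c + n • w + d)) (fderiv ℝ (F τ) (c + n • w + d) w) n := by
  have hl : HasDerivAt (fun n : ℝ => c + n • w + d) w n := by
    have h := (((hasDerivAt_id n).smul_const w).const_add c).add_const d
    simpa using h
  have hd : DifferentiableAt ℝ (F τ) (c + n • w + d) := (hFτ.differentiable (by norm_num)) _
  exact hd.hasFDerivAt.comp_hasDerivAt n hl

/-- **A cross-section with negative second derivative along the normal is strictly concave on `[−r, r]`.** -/
theorem strictConcaveOn_crossSection {τ : ℝ} (hFτ : ContDiff ℝ 2 (F τ)) (c w d : EuclideanSpace ℝ (Fin 3)) {r : ℝ}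
    (hneg : ∀ n ∈ Ioo (-r) r, fderiv ℝ (fderiv ℝ (F τ)) (c + n • w + d) w w < 0) :
    StrictConcaveOn ℝ (Icc (-r) r) fun n : ℝ => F τ (c + n • w + d) := by
  -- first derivative as a function
  have hd1 : deriv (fun n : ℝ => F τ (c + n • w + d)) = fun n => fderiv ℝ (F τ) (c + n • w + d) w :=
    funext fun n => (hasDerivAt_crossSection hFτ c w d n).deriv
  -- second derivative: differentiate `φ = ∂_w (F τ)` along the line
  have hD1 : ContDiff ℝ 1 (fderiv ℝ (F τ)) := hFτ.fderiv_right le_rfl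
  set A : (EuclideanSpace ℝ (Fin 3) →L[ℝ] ℝ) →L[ℝ] ℝ := ContinuousLinearMap.apply ℝ ℝ w with hA
  set φ : EuclideanSpace ℝ (Fin 3) → ℝ := fun y => fderiv ℝ (F τ) y w with hφ
  have hφA : φ = A ∘ fderiv ℝ (F τ) := by funext y; simp [hφ, hA]
  have hφd : Differentiable ℝ φ := by rw [hφA]; exact (A.contDiff.comp hD1).differentiable one_ne_zero
  have hDφ : ∀ y v, fderiv ℝ φ y v = fderiv ℝ (fderiv ℝ (F τ)) y v w := by
    intro y v
    have h : HasFDerivAt φ (A.comp (fderiv ℝ (fderiv ℝ (F τ)) y)) y := by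
      rw [hφA]; exact A.hasFDerivAt.comp y ((hD1.differentiable one_ne_zero) y).hasFDerivAt
    rw [h.fderiv]; simp [hA]
  have hd2 : ∀ n, deriv (deriv (fun n : ℝ => F τ (c + n • w + d))) n = fderiv ℝ (fderiv ℝ (F τ)) (c + n • w + d) w w := by
    intro n
    rw [hd1]
    have hl : HasDerivAt (fun n : ℝ => c + n • w + d) w n := by
      have h := (((hasDerivAt_id n).smul_const w).const_add c).add_const d
      simpa using h
    have h := (hφd (c + n • w + d)).hasFDerivAt.comp_hasDerivAt n hl
    rw [show (fun n : ℝ => fderiv ℝ (F τ) (c + n • w + d) w) = φ ∘ fun n : ℝ => c + n • w + d from rfl, h.deriv, hDφ]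
  refine strictConcaveOn_of_deriv2_neg (convex_Icc _ _) ?_ fun n hn => ?_
  · exact ((hFτ.continuous).comp (by fun_prop : Continuous fun n : ℝ => c + n • w + d)).continuousOn
  · rw [interior_Icc] at hn
    rw [Function.iterate_succ_apply', Function.iterate_one, hd2 n]
    exact hneg n hn

/-- **Danskin's differentiability hypothesis for the cross-section family** `(τ,z) ↦ F τ (c + n • w + z • e)`: with `A_n (τ,z) = (τ, c + n•w + z•e)` (affine, derivative
`M (h₁,h₂) = (h₁, h₂•e)`), the family has derivative `D(uncurry F)(A_n p) ∘ M` at every `p` with `p.1 ∈ T`. -/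
theorem hasFDerivAt_crossSectionFamily (hT : IsOpen T) (hF : ContDiffOn ℝ 2 (uncurry F) (T ×ˢ (univ : Set (EuclideanSpace ℝ (Fin 3)))))
    (c w e : EuclideanSpace ℝ (Fin 3)) (n : ℝ) {p : ℝ × ℝ} (hp : p.1 ∈ T) :
    HasFDerivAt (fun p : ℝ × ℝ => F p.1 (c + n • w + p.2 • e))
      ((fderiv ℝ (uncurry F) (p.1, c + n • w + p.2 • e)).comp
        ((ContinuousLinearMap.fst ℝ ℝ ℝ).prod ((ContinuousLinearMap.snd ℝ ℝ ℝ).smulRight e))) p := by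
  have hA : HasFDerivAt (fun p : ℝ × ℝ => ((p.1, c + n • w + p.2 • e) : ℝ × EuclideanSpace ℝ (Fin 3)))
      ((ContinuousLinearMap.fst ℝ ℝ ℝ).prod ((ContinuousLinearMap.snd ℝ ℝ ℝ).smulRight e)) p := by
    refine hasFDerivAt_fst.prodMk ?_
    have h := (hasFDerivAt_snd (𝕜 := ℝ) (E := ℝ) (F := ℝ) (p := p)).smul_const e
    exact h.const_add (c + n • w)
  have hmem : (p.1, c + n • w + p.2 • e) ∈ T ×ˢ (univ : Set (EuclideanSpace ℝ (Fin 3))) := ⟨hp, mem_univ _⟩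
  have hd : DifferentiableAt ℝ (uncurry F) (p.1, c + n • w + p.2 • e) :=
    (hF.differentiableOn (by norm_num)).differentiableAt ((hT.prod isOpen_univ).mem_nhds hmem)
  exact hd.hasFDerivAt.comp p hA

variable {Γ ν : ℝ → EuclideanSpace ℝ (Fin 3)} {R m : ℝ → ℝ → ℝ} {δ r B : ℝ}

/-- **ONE-SHOT WEB FERMAT.**  See the module docstring. -/
theorem web_fermat (hT : IsOpen T) (hF : ContDiffOn ℝ 2 (uncurry F) (T ×ˢ (univ : Set (EuclideanSpace ℝ (Fin 3))))) (hδT : Ioo (-δ) δ ⊆ T)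
    (hΓ2 : ContDiff ℝ 2 Γ) (hplane : ∀ s, Γ s 2 = 0) (hunit : ∀ s, ‖deriv Γ s‖ = 1) (hB : ∀ s, ‖deriv (deriv Γ) s‖ ≤ B)
    (hν : ∀ s, ν s = WithLp.toLp 2 ![-(deriv Γ s 1), deriv Γ s 0, 0]) (hr : 0 < r) (hrB : r * B < 1)
    (hR : ∀ τ z, R τ z = sSup ((fun n : ℝ => F τ (Γ 0 + n • ν 0 + z • EuclideanSpace.single 2 (1 : ℝ))) '' Icc (-r) r))
    (hconst : ∀ τ z : ℝ, |τ| < δ → |z| < δ → ∀ s : ℝ,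
      sSup ((fun n : ℝ => F τ (Γ s + n • ν s + z • EuclideanSpace.single 2 (1 : ℝ))) '' Icc (-r) r) =
        sSup ((fun n : ℝ => F τ (Γ 0 + n • ν 0 + z • EuclideanSpace.single 2 (1 : ℝ))) '' Icc (-r) r))
    (hlat : ∀ τ z : ℝ, |τ| < δ → |z| < δ → ∀ s n : ℝ, (n = r ∨ n = -r) → F τ (Γ s + n • ν s + z • EuclideanSpace.single 2 (1 : ℝ)) < m τ z)
    (hmid : ∀ τ z : ℝ, |τ| < δ → |z| < δ → ∀ s : ℝ, m τ z ≤ F τ (Γ s + z • EuclideanSpace.single 2 (1 : ℝ)))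
    (hconc : ∀ τ z : ℝ, |τ| < δ → |z| < δ → ∀ s : ℝ, ∀ n ∈ Ioo (-r) r,
      fderiv ℝ (fderiv ℝ (F τ)) (Γ s + n • ν s + z • EuclideanSpace.single 2 (1 : ℝ)) (ν s) (ν s) < 0)
    {τ₀ z₀ : ℝ} (hτ₀ : |τ₀| < δ) (hz₀ : |z₀| < δ) (s₀ : ℝ) :
    ∃ n₀ ∈ Ioo (-r) r,
      F τ₀ (Γ s₀ + n₀ • ν s₀ + z₀ • EuclideanSpace.single 2 (1 : ℝ)) = R τ₀ z₀ ∧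
      (∀ n ∈ Icc (-r) r, n ≠ n₀ → F τ₀ (Γ s₀ + n • ν s₀ + z₀ • EuclideanSpace.single 2 (1 : ℝ)) < R τ₀ z₀) ∧
      DifferentiableAt ℝ (uncurry R) (τ₀, z₀) ∧
      fderiv ℝ (uncurry F) (τ₀, Γ s₀ + n₀ • ν s₀ + z₀ • EuclideanSpace.single 2 (1 : ℝ)) =
        (fderiv ℝ (uncurry R) (τ₀, z₀)).comp
          ((ContinuousLinearMap.fst ℝ ℝ (EuclideanSpace ℝ (Fin 3))).prod
            ((EuclideanSpace.proj (2 : Fin 3)).comp (ContinuousLinearMap.snd ℝ ℝ (EuclideanSpace ℝ (Fin 3))))) := by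
  set e₂ : EuclideanSpace ℝ (Fin 3) := EuclideanSpace.single 2 (1 : ℝ) with he₂
  have hτ₀T : τ₀ ∈ T := hδT ⟨(abs_lt.1 hτ₀).1, (abs_lt.1 hτ₀).2⟩
  have hFτ₀ : ContDiff ℝ 2 (F τ₀) := contDiff_slice hF hτ₀T
  -- ## the web point of a cross-section `s` at `(τ₀, z₀)`: unique maximiser in the open core (Argmax), value `R τ₀ z₀`
  have hweb : ∀ s : ℝ, ∃ n₀ ∈ Ioo (-r) r, IsMaxOn (fun n : ℝ => F τ₀ (Γ s + n • ν s + z₀ • e₂)) (Icc (-r) r) n₀ ∧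
      ∀ n ∈ Icc (-r) r, n ≠ n₀ → F τ₀ (Γ s + n • ν s + z₀ • e₂) < F τ₀ (Γ s + n₀ • ν s + z₀ • e₂) := by
    intro s
    refine exists_unique_argmax hr le_rfl ((hFτ₀.continuous.comp (by fun_prop : Continuous fun n : ℝ => Γ s + n • ν s + z₀ • e₂)).continuousOn)
      (strictConcaveOn_crossSection hFτ₀ (Γ s) (ν s) (z₀ • e₂) (hconc τ₀ z₀ hτ₀ hz₀ s)) fun n hn hrn => ?_
    -- `r ≤ |n| ≤ r` forces `n = ±r`, a cold lateral point
    have hnr : n = r ∨ n = -r := by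
      have h1 : |n| ≤ r := abs_le.2 ⟨hn.1, hn.2⟩
      have h2 : |n| = r := le_antisymm h1 hrn
      rcases le_or_gt 0 n with h | h
      · left; rw [abs_of_nonneg h] at h2; exact h2
      · right; rw [abs_of_neg h] at h2; linarith
    have h1 := hlat τ₀ z₀ hτ₀ hz₀ s n hnr
    have h2 := hmid τ₀ z₀ hτ₀ hz₀ s
    simp only [zero_smul, add_zero]
    linarith
  -- the value at a maximiser is the cross-section sup, hence `R τ₀ z₀`
  have hval : ∀ s n₀, IsMaxOn (fun n : ℝ => F τ₀ (Γ s + n • ν s + z₀ • e₂)) (Icc (-r) r) n₀ → n₀ ∈ Icc (-r) r →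
      F τ₀ (Γ s + n₀ • ν s + z₀ • e₂) = R τ₀ z₀ := by
    intro s n₀ hmax hn₀
    have h : sSup ((fun n : ℝ => F τ₀ (Γ s + n • ν s + z₀ • e₂)) '' Icc (-r) r) = F τ₀ (Γ s + n₀ • ν s + z₀ • e₂) :=
      IsGreatest.csSup_eq ⟨⟨n₀, hn₀, rfl⟩, by rintro _ ⟨n, hn, rfl⟩; exact hmax hn⟩
    rw [hR, ← hconst τ₀ z₀ hτ₀ hz₀ s, h]
  obtain ⟨n₀, hn₀, hmax₀, huniq₀⟩ := hweb s₀
  have hn₀I : n₀ ∈ Icc (-r) r := Ioo_subset_Icc_self hn₀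
  have heq : F τ₀ (Γ s₀ + n₀ • ν s₀ + z₀ • e₂) = R τ₀ z₀ := hval s₀ n₀ hmax₀ hn₀I
  -- ## differentiability of `R` at `(τ₀, z₀)`: Danskin on the `0`-cross-section family
  obtain ⟨k₀, hk₀, hmaxk, huniqk⟩ := hweb 0
  have hk₀I : k₀ ∈ Icc (-r) r := Ioo_subset_Icc_self hk₀
  set g : ℝ × ℝ → ℝ → ℝ := fun p n => F p.1 (Γ 0 + n • ν 0 + p.2 • e₂) with hg
  set M : ℝ × ℝ →L[ℝ] ℝ × EuclideanSpace ℝ (Fin 3) := (ContinuousLinearMap.fst ℝ ℝ ℝ).prod ((ContinuousLinearMap.snd ℝ ℝ ℝ).smulRight e₂) with hM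
  set D : ℝ × ℝ → ℝ → (ℝ × ℝ →L[ℝ] ℝ) := fun p n => (fderiv ℝ (uncurry F) (p.1, Γ 0 + n • ν 0 + p.2 • e₂)).comp M with hD
  have hTev : ∀ᶠ p in 𝓝 ((τ₀, z₀) : ℝ × ℝ), p.1 ∈ T := (continuous_fst.continuousAt).eventually (hT.mem_nhds hτ₀T)
  have hcontF : ContinuousOn (uncurry F) (T ×ˢ (univ : Set (EuclideanSpace ℝ (Fin 3)))) := hF.continuousOn
  have hcont : ∀ n ∈ Icc (-r) r, ContinuousAt (fun q : (ℝ × ℝ) × ℝ => g q.1 q.2) ((τ₀, z₀), n) := by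
    intro n _
    have hA : Continuous fun q : (ℝ × ℝ) × ℝ => ((q.1.1, Γ 0 + q.2 • ν 0 + q.1.2 • e₂) : ℝ × EuclideanSpace ℝ (Fin 3)) := by fun_prop
    have hmem : ((τ₀, z₀), n).1.1 ∈ T := hτ₀T
    exact (hcontF.continuousAt ((hT.prod isOpen_univ).mem_nhds ⟨hmem, mem_univ _⟩)).comp hA.continuousAt
  have hslice : ∀ᶠ p in 𝓝 ((τ₀, z₀) : ℝ × ℝ), ContinuousOn (g p) (Icc (-r) r) := by
    filter_upwards [hTev] with p hp
    exact ((contDiff_slice hF hp).continuous.comp (by fun_prop : Continuous fun n : ℝ => Γ 0 + n • ν 0 + p.2 • e₂)).continuousOn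
  have hDev : ∀ᶠ q in 𝓝 (((τ₀, z₀) : ℝ × ℝ), k₀), HasFDerivAt (fun p => g p q.2) (D q.1 q.2) q.1 := by
    have h : ∀ᶠ q in 𝓝 (((τ₀, z₀) : ℝ × ℝ), k₀), q.1.1 ∈ T :=
      ((continuous_fst.comp continuous_fst).continuousAt).eventually (hT.mem_nhds hτ₀T)
    filter_upwards [h] with q hq
    exact hasFDerivAt_crossSectionFamily hT hF (Γ 0) (ν 0) e₂ q.2 hq
  have hDc : ContinuousAt (fun q : (ℝ × ℝ) × ℝ => D q.1 q.2) ((τ₀, z₀), k₀) := by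
    have hfd : ContinuousOn (fderiv ℝ (uncurry F)) (T ×ˢ (univ : Set (EuclideanSpace ℝ (Fin 3)))) :=
      hF.continuousOn_fderiv_of_isOpen (hT.prod isOpen_univ) (by norm_num)
    have hA : Continuous fun q : (ℝ × ℝ) × ℝ => ((q.1.1, Γ 0 + q.2 • ν 0 + q.1.2 • e₂) : ℝ × EuclideanSpace ℝ (Fin 3)) := by fun_prop
    have h1 : ContinuousAt (fun q : (ℝ × ℝ) × ℝ => fderiv ℝ (uncurry F) (q.1.1, Γ 0 + q.2 • ν 0 + q.1.2 • e₂)) ((τ₀, z₀), k₀) :=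
      (hfd.continuousAt ((hT.prod isOpen_univ).mem_nhds ⟨hτ₀T, mem_univ _⟩)).comp hA.continuousAt
    exact h1.clm_comp continuousAt_const
  have hDanskin := hasFDerivAt_sSup_of_unique_argmax (g := g) (K := Icc (-r) r) isCompact_Icc hcont hslice hk₀I
    (fun n hn hne => huniqk n hn hne) hDev hDc
  have hReq : uncurry R = fun p : ℝ × ℝ => sSup (g p '' Icc (-r) r) := by
    funext p; simp only [uncurry, hR, hg]
  have hRdiff : DifferentiableAt ℝ (uncurry R) (τ₀, z₀) := by rw [hReq]; exact hDanskin.differentiableAt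
  -- ## the LEAD's Fermat lemma at the web point `(s₀, n₀, z₀)`
  have hν2 : ∀ s, ν s 2 = 0 := fun s => by simp [hν s]
  have hn₀B : |n₀| * B < 1 := by
    have hB0 : 0 ≤ B := (norm_nonneg _).trans (hB 0)
    have : |n₀| ≤ r := (abs_lt.2 ⟨hn₀.1, hn₀.2⟩).le
    calc |n₀| * B ≤ r * B := mul_le_mul_of_nonneg_right this hB0
      _ < 1 := hrB
  have hΨ := nhds_le_map_frame_of_curvature hΓ2 hplane hunit hB hν (s₀, n₀, z₀) hn₀B
  -- the inequality near the web point
  have hle : ∀ᶠ p in 𝓝 ((τ₀, (s₀, n₀, z₀)) : ℝ × (ℝ × ℝ × ℝ)), F p.1 (Γ p.2.1 + p.2.2.1 • ν p.2.1 + p.2.2.2 • e₂) ≤ R p.1 p.2.2.2 := by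
    have h1 : ∀ᶠ p in 𝓝 ((τ₀, (s₀, n₀, z₀)) : ℝ × (ℝ × ℝ × ℝ)), |p.1| < δ := by
      exact ((continuous_fst.abs).tendsto ((τ₀, (s₀, n₀, z₀)) : ℝ × (ℝ × ℝ × ℝ))).eventually_lt_const hτ₀
    have h2 : ∀ᶠ p in 𝓝 ((τ₀, (s₀, n₀, z₀)) : ℝ × (ℝ × ℝ × ℝ)), |p.2.2.1| < r := by
      exact (((continuous_fst.comp (continuous_snd.comp continuous_snd)).abs).tendsto ((τ₀, (s₀, n₀, z₀)) : ℝ × (ℝ × ℝ × ℝ))).eventually_lt_const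
        (abs_lt.2 ⟨hn₀.1, hn₀.2⟩)
    have h3 : ∀ᶠ p in 𝓝 ((τ₀, (s₀, n₀, z₀)) : ℝ × (ℝ × ℝ × ℝ)), |p.2.2.2| < δ := by
      exact (((continuous_snd.comp (continuous_snd.comp continuous_snd)).abs).tendsto ((τ₀, (s₀, n₀, z₀)) : ℝ × (ℝ × ℝ × ℝ))).eventually_lt_const hz₀
    filter_upwards [h1, h2, h3] with p hp1 hp2 hp3
    have hτT : p.1 ∈ T := hδT ⟨(abs_lt.1 hp1).1, (abs_lt.1 hp1).2⟩
    have hK : IsCompact ((fun n : ℝ => F p.1 (Γ p.2.1 + n • ν p.2.1 + p.2.2.2 • e₂)) '' Icc (-r) r) :=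
      isCompact_Icc.image ((contDiff_slice hF hτT).continuous.comp (by fun_prop))
    rw [hR, ← hconst p.1 p.2.2.2 hp1 hp3 p.2.1]
    exact le_csSup hK.bddAbove ⟨p.2.2.1, ⟨(abs_lt.1 hp2).1.le, (abs_lt.1 hp2).2.le⟩, rfl⟩
  have hFdiff : DifferentiableAt ℝ (uncurry F) (τ₀, Γ s₀ + n₀ • ν s₀ + z₀ • e₂) :=
    (hF.differentiableOn (by norm_num)).differentiableAt ((hT.prod isOpen_univ).mem_nhds ⟨hτ₀T, mem_univ _⟩)
  have hfermat := fderiv_uncurry_eq_of_ridgeWeb (F := F) (R := R) (q₀ := (s₀, n₀, z₀)) hplane hν2 hΨ hle heq hFdiff hRdiff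
  refine ⟨n₀, hn₀, heq, fun n hn hne => ?_, hRdiff, hfermat⟩
  rw [← heq]; exact huniq₀ n hn hne

end Summit.NavierStokesRegularity.NavierStokesRegularity.Theorems.PoloidalWindowDoorLrcModEntireRidgeWebFermat

end
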